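import Summits.ValiantsHypothesis.ValiantsHypothesis.Theses.BarrierLever
import Summits.ValiantsHypothesis.ValiantsHypothesis.Theorems.BarrierLeverPartitionMinorsHitByVPHiddenStatesGadgetDoor
import Summits.ValiantsHypothesis.ValiantsHypothesis.Theorems.BarrierLeverPartitionMinorsHitByVPHiddenStatesFit

/-!
# Route BarrierLever — item `PartitionMinorsHitByVP` (stmt-ValiantsHypothesis-19717):
# the by-name node GADGET-UNIVERSAL (line `hidden_states`; planner ruling R45)

Helper file (`--supports stmt-ValiantsHypothesis-19717`; cell valiant-natproofs, rung V4, 𝒟-side of door (c);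
prover seat val-np-p3 gen 20). One typed statement (a `Prop`, NOT asserted) and two kernel arrows. Closes NO item.

* `Stmt.gadgetUniversal` (GU) — for all large `h` and every `r ≤ 2^h` ONE gadget design (`m ≤ 2h` pieces, `t ≤ h³` slots of
  `s` options, `t·s ≤ 4h³`; option `(p,l,o)` = a state set `D p l o` with a slot cost; piece offsets; an injective threshold
  family `e` of (piece, option choice per slot) for the slot-additive weight, the chosen sets of a column pairwise disjoint)
  whose block-additive matrix `[∏_{a∈u i} (T p none a + Σ_{q ∈ ⋃_l D p l (φ_k l)} T p (some q) a)]` is nonsingular at some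
  table for EVERY injective `u`. This is the text the planner asked for (R45) to re-seat node #1 of the line.
* **`partitionMinorsHitByVP_of_gadgetUniversal : Stmt.gadgetUniversal → PartitionMinorsHitByVP`** (`b = 8`, `h₀ = max h₁ 3`;
  the gadget join door `GadgetDoor.partitionMinor_hit_of_gadgetStates_mem`).
* **`gadgetUniversal_of_universalJoinWide : SymbJoin.Stmt.universalJoinWide → Stmt.gadgetUniversal`** — GU is WEAKER than
  the registered node `stub_universalJoinWide` (a threshold join of `K ≤ h³` states is the gadget design with one slot per
  state and the two options `∅` (cost `0`) / `{k}` (cost `wt p k`)), so the swap `universalJoinWide ↦ gadgetUniversal` loses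
  nothing; block designs (matchings, `B₂([b])` blocks; memo MEMO-blockpeeling-valnp3-g20) live in GU and not in the old node.

WHAT THIS IS NOT: GU is not proved; item 19717 stays OPEN; nothing on crux 14610 or VP ≠ VNP.
-/

set_option linter.dupNamespace false

namespace Summit.ValiantsHypothesis.ValiantsHypothesis.Theorems.BarrierLever.HiddenStates

open Finset Matrix

noncomputable section

namespace GadgetDoor

/-- **GADGET-UNIVERSAL (typed; not asserted).** For all large `h` and every `r ≤ 2^h` there is ONE gadget design —
`m ≤ 2h` pieces, `t ≤ h³` slots with `s` options each (`t·s ≤ 4h³`), option `o` of slot `l` of piece `p` being a state set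
`D p l o ⊆ Fin K` of cost `cost p l o`, piece offsets `W`, and an injective THRESHOLD family
`e : Fin r → Fin m × (Fin t → Fin s)` of the slot-additive weight `(p, φ) ↦ W p + Σ_l cost p l (φ l)` whose chosen sets
`D p l (φ l)`, `l < t`, are pairwise disjoint for every column — such that for EVERY injective `u : Fin r → Finset (Fin h)`
some state table `T` makes the block-additive matrix `[∏_{a ∈ u i} (T p none a + Σ_{q ∈ ⋃_l D p l (φ l)} T p (some q) a)]`,
column `k ↦ (p, φ) = e k`, nonsingular. -/
def Stmt.gadgetUniversal : Prop :=
  ∃ h₁ : ℕ, ∀ h : ℕ, h₁ ≤ h → ∀ r : ℕ, r ≤ 2 ^ h →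
    ∃ (m t s K : ℕ) (D : Fin m → Fin t → Fin s → Finset (Fin K)) (W : Fin m → ℕ)
      (cost : Fin m → Fin t → Fin s → ℕ) (e : Fin r → Fin m × (Fin t → Fin s)),
      m ≤ h + h ∧ t ≤ h * h * h ∧ t * s ≤ 4 * (h * h * h) ∧ Function.Injective e ∧
      (∀ x : Fin m × (Fin t → Fin s), x ∉ Set.range e →
        ∀ k, W (e k).1 + ∑ l, cost (e k).1 l ((e k).2 l) < W x.1 + ∑ l, cost x.1 l (x.2 l)) ∧
      (∀ k, (Set.univ : Set (Fin t)).PairwiseDisjoint fun l => D (e k).1 l ((e k).2 l)) ∧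
      ∀ u : Fin r → Finset (Fin h), Function.Injective u →
        ∃ T : Fin m → Option (Fin K) → Fin h → ℂ,
          (Matrix.of fun i k : Fin r => ∏ a ∈ u i,
            (T (e k).1 none a + ∑ q ∈ (Finset.univ.biUnion fun l => D (e k).1 l ((e k).2 l)),
              T (e k).1 (some q) a)).det ≠ 0

/-- **The crux from GADGET-UNIVERSAL** (gadget join door, `b = 8`). -/
theorem partitionMinorsHitByVP_of_gadgetUniversal (H : Stmt.gadgetUniversal) :
    Summit.ValiantsHypothesis.ValiantsHypothesis.Theses.BarrierLever.PartitionMinorsHitByVP := by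
  obtain ⟨h₁, H⟩ := H
  refine ⟨8, max h₁ 3, fun h hh r u w hu hw => ?_⟩
  have hh₁ : h₁ ≤ h := le_trans (le_max_left _ _) hh
  have hh3 : 3 ≤ h := le_trans (le_max_right _ _) hh
  have hr : r ≤ 2 ^ h := by
    have := Fintype.card_le_of_injective u hu
    rwa [Fintype.card_fin, Fintype.card_finset, Fintype.card_fin] at this
  obtain ⟨m, t, s, K, D, W, cost, e, hm, ht, hts, he, hthr, hdisj, HU⟩ := H h hh₁ r hr
  obtain ⟨T, hT⟩ := HU u hu
  obtain ⟨S, hS⟩ := HU w hw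
  exact partitionMinor_hit_of_gadgetStates_mem h m t s K r hh3 hm ht hts u w D e he W cost hthr
    (fun k => Finset.univ.biUnion fun l => D (e k).1 l ((e k).2 l)) (fun _ => rfl) hdisj T S hT hS

/-! ## The registered node implies GU: a threshold join is a gadget design with trivial blocks -/

section Trivial

variable {K : ℕ}

/-- The indicator option choice of a state set: slot `l` takes option `1` iff `l ∈ J`. -/
def indOpt (J : Finset (Fin K)) : Fin K → Fin 2 := fun l => if l ∈ J then 1 else 0

/-- The state set of an option choice. -/
def setOf (φ : Fin K → Fin 2) : Finset (Fin K) := Finset.univ.filter fun l => φ l = 1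

/-- `setOf ∘ indOpt = id`. -/
theorem setOf_indOpt (J : Finset (Fin K)) : setOf (indOpt J) = J := by
  ext l
  simp only [setOf, indOpt, Finset.mem_filter, Finset.mem_univ, true_and]
  by_cases hl : l ∈ J <;> simp [hl]

/-- `indOpt ∘ setOf = id` (an element of `Fin 2` other than `1` is `0`). -/
theorem indOpt_setOf (φ : Fin K → Fin 2) : indOpt (setOf φ) = φ := by
  funext l
  simp only [indOpt, setOf, Finset.mem_filter, Finset.mem_univ, true_and]
  have key : ∀ i : Fin 2, i ≠ 1 → i = 0 := by decide
  by_cases hl : φ l = 1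
  · rw [if_pos hl, hl]
  · rw [if_neg hl, key _ hl]

/-- `indOpt` is injective. -/
theorem indOpt_injective : Function.Injective (indOpt (K := K)) := fun J J' hJ => by
  rw [← setOf_indOpt J, ← setOf_indOpt J', hJ]

/-- The trivial blocks: option `1` of slot `l` is the state set `{l}`, option `0` is `∅`. -/
def trivD (l : Fin K) (o : Fin 2) : Finset (Fin K) := if o = 1 then {l} else ∅

/-- The trivial costs: option `1` of slot `l` costs `wt l`, option `0` costs `0`. -/
def trivCost (wt : Fin K → ℕ) (l : Fin K) (o : Fin 2) : ℕ := if o = 1 then wt l else 0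

/-- A member of a trivial block is its slot. -/
theorem eq_of_mem_trivD {l q : Fin K} {o : Fin 2} (hq : q ∈ trivD l o) : q = l := by
  unfold trivD at hq
  split_ifs at hq with ho
  · exact Finset.mem_singleton.mp hq
  · simp at hq

/-- The slot-additive cost of an option choice is the additive weight of its state set. -/
theorem sum_trivCost (wt : Fin K → ℕ) (φ : Fin K → Fin 2) :
    ∑ l, trivCost wt l (φ l) = ∑ k ∈ setOf φ, wt k := by
  rw [setOf, Finset.sum_filter]
  rfl

/-- The union of the chosen trivial blocks of an option choice is its state set. -/
theorem biUnion_trivD (φ : Fin K → Fin 2) : (Finset.univ.biUnion fun l => trivD l (φ l)) = setOf φ := by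
  ext q
  simp only [Finset.mem_biUnion, Finset.mem_univ, true_and, setOf, Finset.mem_filter]
  constructor
  · rintro ⟨l, hl⟩
    have hql : q = l := eq_of_mem_trivD hl
    subst hql
    unfold trivD at hl
    split_ifs at hl with ho
    · exact ho
    · simp at hl
  · intro hq
    refine ⟨q, ?_⟩
    unfold trivD
    rw [if_pos hq]
    exact Finset.mem_singleton_self q

/-- The chosen trivial blocks of a column are pairwise disjoint. -/
theorem pairwiseDisjoint_trivD (φ : Fin K → Fin 2) :
    (Set.univ : Set (Fin K)).PairwiseDisjoint fun l => trivD l (φ l) := by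
  intro l₁ _ l₂ _ hne
  refine Finset.disjoint_left.mpr fun q hq₁ hq₂ => hne ?_
  rw [← eq_of_mem_trivD hq₁, ← eq_of_mem_trivD hq₂]

end Trivial

/-- **The registered node implies GADGET-UNIVERSAL.** A legal wide join threshold design (`m ≤ 2h` pieces, `K ≤ h³`
states, additive weight `W p + Σ_{k∈J} wt p k`) is the gadget design with one slot per state, options `∅` / `{k}` of costs
`0` / `wt p k` (`t = K`, `s = 2`, `t·s = 2K ≤ 4h³`), the column `(p, J)` becoming `(p, indOpt J)`; weights, threshold
legality and matrices are carried over verbatim. -/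
theorem gadgetUniversal_of_universalJoinWide (H : SymbJoin.Stmt.universalJoinWide) : Stmt.gadgetUniversal := by
  obtain ⟨h₁, H⟩ := H
  refine ⟨h₁, fun h hh r hr => ?_⟩
  obtain ⟨m, K, W, wt, e, hm, hK, he, hthr, HU⟩ := H h hh r hr
  refine ⟨m, K, 2, K, fun _ l o => trivD l o, W, fun p l o => trivCost (wt p) l o,
    fun k => ((e k).1, indOpt (e k).2), hm, hK, by omega, ?_, ?_, ?_, ?_⟩
  · -- injectivity
    intro k k' hkk'
    simp only [Prod.mk.injEq] at hkk'
    exact he (Prod.ext hkk'.1 (indOpt_injective hkk'.2))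
  · -- threshold legality
    intro x hx k
    have hx' : (x.1, setOf x.2) ∉ Set.range e := by
      rintro ⟨k', hk'⟩
      refine hx ⟨k', ?_⟩
      change ((e k').1, indOpt (e k').2) = x
      rw [hk', indOpt_setOf]
    have := hthr _ hx' k
    simp only [sum_trivCost, setOf_indOpt]
    exact this
  · -- disjoint blocks
    intro k
    exact pairwiseDisjoint_trivD _
  · -- the matrices are those of the threshold design
    intro u hu
    obtain ⟨tx, htx⟩ := HU u hu
    refine ⟨tx, ?_⟩
    simp only [biUnion_trivD, setOf_indOpt]
    exact htx

/-! ## Calibrated budget (appended): non-empty options per piece `≤ h³`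

`Stmt.gadgetUniversal` allows `t·s ≤ 4h³` options per piece, four times the `K ≤ h³` states of the registered node; a single
slot with `4h³` options (origin + points) is then a legal, trivially uniform design, so GU-cells are not comparable with the
node's cells (seat memo MEMO-blockpeeling-valnp3-g20 §12). The CALIBRATED text below charges one unit per NON-EMPTY option:
`t ≤ h³ ∧ t·(s − 1) ≤ h³`. The registered node embeds with `t = K`, `s = 2` (`t·(s−1) = K`), one-slot stars give exactly the
node's `2h(h³ + 1)` columns, and GUcal implies GU (`t·s = t(s−1) + t ≤ 2h³`). -/

/-- **GADGET-UNIVERSAL, calibrated (typed; not asserted).** As `Stmt.gadgetUniversal` with the option budget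
`t ≤ h³ ∧ t·(s − 1) ≤ h³` (at most `h³` slots and at most `h³` non-empty options per piece) in place of `t ≤ h³ ∧ t·s ≤ 4h³`. -/
def Stmt.gadgetUniversalCal : Prop :=
  ∃ h₁ : ℕ, ∀ h : ℕ, h₁ ≤ h → ∀ r : ℕ, r ≤ 2 ^ h →
    ∃ (m t s K : ℕ) (D : Fin m → Fin t → Fin s → Finset (Fin K)) (W : Fin m → ℕ)
      (cost : Fin m → Fin t → Fin s → ℕ) (e : Fin r → Fin m × (Fin t → Fin s)),
      m ≤ h + h ∧ t ≤ h * h * h ∧ t * (s - 1) ≤ h * h * h ∧ Function.Injective e ∧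
      (∀ x : Fin m × (Fin t → Fin s), x ∉ Set.range e →
        ∀ k, W (e k).1 + ∑ l, cost (e k).1 l ((e k).2 l) < W x.1 + ∑ l, cost x.1 l (x.2 l)) ∧
      (∀ k, (Set.univ : Set (Fin t)).PairwiseDisjoint fun l => D (e k).1 l ((e k).2 l)) ∧
      ∀ u : Fin r → Finset (Fin h), Function.Injective u →
        ∃ T : Fin m → Option (Fin K) → Fin h → ℂ,
          (Matrix.of fun i k : Fin r => ∏ a ∈ u i,
            (T (e k).1 none a + ∑ q ∈ (Finset.univ.biUnion fun l => D (e k).1 l ((e k).2 l)),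
              T (e k).1 (some q) a)).det ≠ 0

/-- The calibrated budget is within the door's budget: `t ≤ h³ ∧ t(s−1) ≤ h³ ⇒ t·s ≤ 4h³`. -/
theorem budget_of_cal {h t s : ℕ} (ht : t ≤ h * h * h) (hts : t * (s - 1) ≤ h * h * h) :
    t * s ≤ 4 * (h * h * h) := by
  rcases Nat.eq_zero_or_pos s with hs | hs
  · subst hs; simp
  · have : t * s = t * (s - 1) + t := by
      obtain ⟨s', rfl⟩ := Nat.exists_eq_add_of_le hs
      simp [mul_add, add_comm]
    omega

/-- **GUcal ⇒ GU.** -/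
theorem gadgetUniversal_of_gadgetUniversalCal (H : Stmt.gadgetUniversalCal) : Stmt.gadgetUniversal := by
  obtain ⟨h₁, H⟩ := H
  refine ⟨h₁, fun h hh r hr => ?_⟩
  obtain ⟨m, t, s, K, D, W, cost, e, hm, ht, hts, he, hthr, hdisj, HU⟩ := H h hh r hr
  exact ⟨m, t, s, K, D, W, cost, e, hm, ht, budget_of_cal ht hts, he, hthr, hdisj, HU⟩

/-- **The crux from GUcal** (`b = 8`). -/
theorem partitionMinorsHitByVP_of_gadgetUniversalCal (H : Stmt.gadgetUniversalCal) :
    Summit.ValiantsHypothesis.ValiantsHypothesis.Theses.BarrierLever.PartitionMinorsHitByVP :=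
  partitionMinorsHitByVP_of_gadgetUniversal (gadgetUniversal_of_gadgetUniversalCal H)

/-- **The registered node implies GUcal** (trivial blocks: `t = K ≤ h³` slots, `s = 2`, `t·(s−1) = K ≤ h³`). -/
theorem gadgetUniversalCal_of_universalJoinWide (H : SymbJoin.Stmt.universalJoinWide) : Stmt.gadgetUniversalCal := by
  obtain ⟨h₁, H⟩ := H
  refine ⟨h₁, fun h hh r hr => ?_⟩
  obtain ⟨m, K, W, wt, e, hm, hK, he, hthr, HU⟩ := H h hh r hr
  refine ⟨m, K, 2, K, fun _ l o => trivD l o, W, fun p l o => trivCost (wt p) l o,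
    fun k => ((e k).1, indOpt (e k).2), hm, hK, by omega, ?_, ?_, ?_, ?_⟩
  · intro k k' hkk'
    simp only [Prod.mk.injEq] at hkk'
    exact he (Prod.ext hkk'.1 (indOpt_injective hkk'.2))
  · intro x hx k
    have hx' : (x.1, setOf x.2) ∉ Set.range e := by
      rintro ⟨k', hk'⟩
      refine hx ⟨k', ?_⟩
      change ((e k').1, indOpt (e k').2) = x
      rw [hk', indOpt_setOf]
    have := hthr _ hx' k
    simp only [sum_trivCost, setOf_indOpt]
    exact this
  · intro k
    exact pairwiseDisjoint_trivD _
  · intro u hu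
    obtain ⟨tx, htx⟩ := HU u hu
    refine ⟨tx, ?_⟩
    simp only [biUnion_trivD, setOf_indOpt]
    exact htx

end GadgetDoor

end

end Summit.ValiantsHypothesis.ValiantsHypothesis.Theorems.BarrierLever.HiddenStates
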